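import Literature.Probability.LatticeModels.RandomClusterSuccessiveConditioning
import Literature.Probability.LatticeModels.RandomClusterMonotonic
import HarnessLib

/-!
# Successive conditioning along an increasing event ("circuits occur even given the arm"), proved

Topic `Literature/Probability/LatticeModels` (trunk `StatMech`, family `crit-ising`). The step of
Kesten's incipient-infinite-cluster argument (H. Kesten, *The incipient infinite cluster in
two-dimensional percolation*, PTRF 73 (1986), proof of Thm. 3, the estimate "(8)": conditionally on
the arm `{0 ↔ ∂B(n)}`, each annulus still contains an open circuit with probability bounded below,
independently of the others, so that the arm but no circuit in `k` annuli costs `(1 - c)^k`) in the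
generality of the finite-graph random-cluster measure `φ = rcMeasure G p q B`, `q ≥ 1`, of the tree,
and in the conditional-cylinder language of `RandomClusterSuccessiveConditioning.lean`:

* `rcMeasure_real_inter_le_mul_inter_of_cylinder_le` — the RELATIVE summation step: if
  `φ(X ∩ {ω ∖ U = ξ}) ≤ θ φ(A ∩ {ω ∖ U = ξ})` for every configuration `ξ` off the region `U`, then
  `φ(X ∩ F) ≤ θ φ(A ∩ F)` for every event `F` determined off `U`
  (`rcMeasure_real_inter_eq_sum_cylinder` twice);
* `rcMeasure_real_inter_compl_inter_cylinder_le` — ONE REGION: if the increasing event `S` has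
  conditional probability `≥ c` given every cylinder of `Uᶜ` (`c φ(C_ξ) ≤ φ(S ∩ C_ξ)`), then for
  every increasing `A`, `φ(A ∩ Sᶜ ∩ C_ξ) ≤ (1 - c) φ(A ∩ C_ξ)`: by strong positive association
  (`rcMeasure_real_fkg_cylinder`, Grimmett 2006 Thm. (3.8)(b)) `A` only helps `S`;
* `rcMeasure_real_inter_biInter_compl_le` — `N` REGIONS: for pairwise disjoint edge regions `U_i`,
  increasing events `S_i` determined on `U_i` with conditional lower bounds `c_i ≤ 1` uniformly in
  the configuration off `U_i`, and any increasing `A`,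
  `φ(A ∩ ⋂_i S_iᶜ) ≤ (∏_i (1 - c_i)) · φ(A)` (induction over the regions, as in
  `rcMeasure_real_biInter_le_prod`, carrying `A` along).

With `A = {x ↔ y}` and `S_i` = "an open separating set in the `i`-th annulus" this is the input
"the arm from `x` reaches the far target but none of `N` annuli contains an open circuit joined to it
has probability `≤ (1 - c)^N φ(x ↔ y)`" of ratio-limit / arm-origin-forgetting arguments
(Kesten 1986; Garban–Pete–Schramm, JAMS 26 (2013), §3; for FK percolation the RSW lower bounds
uniform in boundary conditions are Duminil-Copin–Hongler–Nolin 2011 / Chelkak–Duminil-Copin–Hongler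
2016). Everything is proved; no definitions.

## References

* H. Kesten, The incipient infinite cluster in two-dimensional percolation, *Probab. Theory
  Related Fields* 73 (1986) 369–394: proof of Thm. 3.
* G. Grimmett, *The Random-Cluster Model*, Springer (2006): Thm. (3.8)(b) (strong positive
  association), §4.2 Lemma (4.13).
* H. Duminil-Copin, S. Smirnov, Conformal invariance of lattice models, *Clay Math. Proc.* 15
  (2012): §6.1, proof of Thm. 6.1 (successive conditioning) — `DuminilCopinSmirnov2012Clay`.
-/

noncomputable section

open MeasureTheory Finset SimpleGraph

namespace Literature.Probability.LatticeModels

section Finite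

variable {V : Type*} [Fintype V] [DecidableEq V] (G : SimpleGraph V) [DecidableRel G.Adj]

/-- **Relative summation over the cylinders of a region.** If for every configuration
`ξ ⊆ E(G) ∖ U` off the region `U`, `φ(X ∩ {ω ∖ U = ξ}) ≤ θ · φ(A ∩ {ω ∖ U = ξ})`, then
`φ(X ∩ F) ≤ θ · φ(A ∩ F)` for every event `F` determined by the configuration off `U`
(decompose both sides along the cylinders, `rcMeasure_real_inter_eq_sum_cylinder`).
[cite: Grimmett2006, §4.2, Lemma (4.13)] -/
theorem rcMeasure_real_inter_le_mul_inter_of_cylinder_le {p q : ℝ} (hp : p ∈ Set.Icc (0 : ℝ) 1)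
    (hq : 0 < q) (B : Set V) (U : Finset (Sym2 V)) {X A F : Set (Percolation.BondConfig V)}
    (hF : ∀ ω₁ ω₂ : Percolation.BondConfig V, ω₁ ∩ (↑U)ᶜ = ω₂ ∩ (↑U)ᶜ → (ω₁ ∈ F ↔ ω₂ ∈ F))
    {θ : ℝ}
    (hθ : ∀ ξ : Finset (Sym2 V), ξ ⊆ G.edgeFinset \ U →
      (rcMeasure G p q B).real (X ∩ {ω | ω ∩ (↑U : Set (Sym2 V))ᶜ = ↑ξ}) ≤
        θ * (rcMeasure G p q B).real (A ∩ {ω | ω ∩ (↑U : Set (Sym2 V))ᶜ = ↑ξ})) :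
    (rcMeasure G p q B).real (X ∩ F) ≤ θ * (rcMeasure G p q B).real (A ∩ F) := by
  classical
  rw [rcMeasure_real_inter_eq_sum_cylinder G hp hq B U X F hF,
    rcMeasure_real_inter_eq_sum_cylinder G hp hq B U A F hF, Finset.mul_sum]
  refine Finset.sum_le_sum fun ξ hξ ↦ ?_
  rw [Finset.mem_filter, Finset.mem_powerset] at hξ
  exact hθ ξ hξ.1

/-- **One region: an increasing event does not suppress a conditionally likely increasing
event** (Kesten 1986, proof of Thm. 3; strong positive association, Grimmett 2006 Thm. (3.8)(b)).
If `S` is increasing with `c · φ(C) ≤ φ(S ∩ C)` on the cylinder `C = {ω | ω ∩ T = ξ}`, then for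
every increasing `A`, `φ(A ∩ Sᶜ ∩ C) ≤ (1 - c) · φ(A ∩ C)`. [cite: Grimmett2006, Thm. (3.8)(b)] -/
theorem rcMeasure_real_inter_compl_inter_cylinder_le {p q : ℝ} (hp : p ∈ Set.Icc (0 : ℝ) 1)
    (hq : 1 ≤ q) (B : Set V) (T ξ : Set (Sym2 V)) {A S : Set (Percolation.BondConfig V)}
    (hA : IsUpperSet A) (hS : IsUpperSet S) {c : ℝ}
    (hc : c * (rcMeasure G p q B).real {ω | ω ∩ T = ξ} ≤
      (rcMeasure G p q B).real (S ∩ {ω | ω ∩ T = ξ})) :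
    (rcMeasure G p q B).real (A ∩ Sᶜ ∩ {ω | ω ∩ T = ξ}) ≤
      (1 - c) * (rcMeasure G p q B).real (A ∩ {ω | ω ∩ T = ξ}) := by
  have hq0 : 0 < q := one_pos.trans_le hq
  haveI := isProbabilityMeasure_rcMeasure G hp hq0 B
  set φ := rcMeasure G p q B with hφ
  set C : Set (Percolation.BondConfig V) := {ω | ω ∩ T = ξ} with hC
  -- strong positive association on the cylinder: `φ(A ∩ C) φ(S ∩ C) ≤ φ(C) φ(A ∩ S ∩ C)`
  have hfkg := rcMeasure_real_fkg_cylinder G hp hq B T ξ hA hS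
  -- split `A ∩ C` along `S`
  have hsplit : φ.real (A ∩ C) = φ.real (A ∩ S ∩ C) + φ.real (A ∩ Sᶜ ∩ C) := by
    have hdisj : Disjoint (A ∩ S ∩ C) (A ∩ Sᶜ ∩ C) := by
      rw [Set.disjoint_left]
      rintro ω ⟨⟨-, hωS⟩, -⟩ ⟨⟨-, hωS'⟩, -⟩
      exact hωS' hωS
    have hunion : A ∩ C = (A ∩ S ∩ C) ∪ (A ∩ Sᶜ ∩ C) := by
      ext ω
      constructor
      · rintro ⟨hωA, hωC⟩
        by_cases hωS : ω ∈ S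
        · exact Or.inl ⟨⟨hωA, hωS⟩, hωC⟩
        · exact Or.inr ⟨⟨hωA, hωS⟩, hωC⟩
      · rintro (⟨⟨hωA, -⟩, hωC⟩ | ⟨⟨hωA, -⟩, hωC⟩) <;> exact ⟨hωA, hωC⟩
    rw [hunion, measureReal_union hdisj MeasurableSet.of_discrete]
  by_cases hC0 : φ.real C = 0
  · -- everything inside a null cylinder vanishes
    have h1 : φ.real (A ∩ Sᶜ ∩ C) = 0 :=
      le_antisymm ((measureReal_mono Set.inter_subset_right (measure_ne_top φ C)).trans hC0.le)
        measureReal_nonneg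
    have h2 : φ.real (A ∩ C) = 0 :=
      le_antisymm ((measureReal_mono Set.inter_subset_right (measure_ne_top φ C)).trans hC0.le)
        measureReal_nonneg
    rw [h1, h2, mul_zero]
  have hCpos : 0 < φ.real C := lt_of_le_of_ne measureReal_nonneg (Ne.symm hC0)
  -- `c φ(A ∩ C) ≤ φ(A ∩ S ∩ C)`
  have hkey : c * φ.real (A ∩ C) ≤ φ.real (A ∩ S ∩ C) := by
    have h1 : φ.real (A ∩ C) * (c * φ.real C) ≤ φ.real (A ∩ C) * φ.real (S ∩ C) :=
      mul_le_mul_of_nonneg_left hc measureReal_nonneg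
    have h2 : φ.real (A ∩ C) * φ.real (S ∩ C) ≤ φ.real C * φ.real (A ∩ S ∩ C) := hfkg
    have h3 : (c * φ.real (A ∩ C)) * φ.real C ≤ φ.real (A ∩ S ∩ C) * φ.real C := by
      calc (c * φ.real (A ∩ C)) * φ.real C = φ.real (A ∩ C) * (c * φ.real C) := by ring
        _ ≤ φ.real C * φ.real (A ∩ S ∩ C) := h1.trans h2
        _ = φ.real (A ∩ S ∩ C) * φ.real C := by ring
    exact le_of_mul_le_mul_right h3 hCpos
  rw [hsplit] at hkey ⊢
  linarith

/-- **Successive conditioning along an increasing event** (Kesten 1986, proof of Thm. 3: "the arm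
but no open circuit in `k` annuli costs `(1 - c)^k`"). Let `U_i`, `i ∈ s`, be pairwise disjoint sets
of edges, `S_i` increasing events determined by the configuration on `U_i`, and `c_i ≤ 1` constants
with `c_i · φ({ω ∖ U_i = ξ}) ≤ φ(S_i ∩ {ω ∖ U_i = ξ})` for every configuration `ξ` off `U_i`. Then for
every increasing event `A`, `φ(A ∩ ⋂_{i ∈ s} S_iᶜ) ≤ (∏_{i ∈ s} (1 - c_i)) · φ(A)` (`0 ≤ p ≤ 1`,
`q ≥ 1`). [cite: Grimmett2006, Thm. (3.8)(b) and Lemma (4.13)] -/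
theorem rcMeasure_real_inter_biInter_compl_le {p q : ℝ} (hp : p ∈ Set.Icc (0 : ℝ) 1) (hq : 1 ≤ q)
    (B : Set V) {ι : Type*} (s : Finset ι) (U : ι → Finset (Sym2 V))
    (hdisj : (s : Set ι).Pairwise fun i j ↦ Disjoint (U i) (U j))
    (S : ι → Set (Percolation.BondConfig V)) (hS : ∀ i ∈ s, IsUpperSet (S i))
    (hSdet : ∀ i ∈ s, ∀ ω₁ ω₂ : Percolation.BondConfig V,
      ω₁ ∩ ↑(U i) = ω₂ ∩ ↑(U i) → (ω₁ ∈ S i ↔ ω₂ ∈ S i))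
    (c : ι → ℝ) (hc1 : ∀ i ∈ s, c i ≤ 1)
    (hc : ∀ i ∈ s, ∀ ξ : Finset (Sym2 V), ξ ⊆ G.edgeFinset \ U i →
      c i * (rcMeasure G p q B).real {ω | ω ∩ (↑(U i) : Set (Sym2 V))ᶜ = ↑ξ} ≤
        (rcMeasure G p q B).real (S i ∩ {ω | ω ∩ (↑(U i) : Set (Sym2 V))ᶜ = ↑ξ}))
    {A : Set (Percolation.BondConfig V)} (hA : IsUpperSet A) :
    (rcMeasure G p q B).real (A ∩ ⋂ i ∈ s, (S i)ᶜ) ≤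
      (∏ i ∈ s, (1 - c i)) * (rcMeasure G p q B).real A := by
  classical
  have hq0 : 0 < q := one_pos.trans_le hq
  haveI := isProbabilityMeasure_rcMeasure G hp hq0 B
  induction s using Finset.induction_on with
  | empty =>
    rw [Finset.prod_empty, one_mul]
    exact measureReal_mono Set.inter_subset_left (measure_ne_top _ _)
  | insert a s ha ih =>
    have hdisj' : ((s : Set ι)).Pairwise fun i j ↦ Disjoint (U i) (U j) :=
      hdisj.mono (by simp)
    have ih' := ih hdisj' (fun i hi ↦ hS i (Finset.mem_insert_of_mem hi))
      (fun i hi ↦ hSdet i (Finset.mem_insert_of_mem hi))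
      (fun i hi ↦ hc1 i (Finset.mem_insert_of_mem hi)) (fun i hi ↦ hc i (Finset.mem_insert_of_mem hi))
    rw [Finset.set_biInter_insert, Finset.prod_insert ha]
    -- `F = ⋂_{i ∈ s} (S i)ᶜ` is determined off `U a`
    have hF : ∀ ω₁ ω₂ : Percolation.BondConfig V, ω₁ ∩ (↑(U a))ᶜ = ω₂ ∩ (↑(U a))ᶜ →
        (ω₁ ∈ ⋂ i ∈ s, (S i)ᶜ ↔ ω₂ ∈ ⋂ i ∈ s, (S i)ᶜ) := by
      intro ω₁ ω₂ h
      simp only [Set.mem_iInter, Set.mem_compl_iff]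
      refine forall₂_congr fun i hi ↦ not_congr ?_
      have hai : a ≠ i := fun h' ↦ ha (h' ▸ hi)
      exact determined_off_of_determined_on_disjoint
        ((hdisj (Finset.mem_insert_of_mem hi) (Finset.mem_insert_self a s) hai.symm))
        (hSdet i (Finset.mem_insert_of_mem hi)) ω₁ ω₂ h
    -- one region, uniformly in the configuration off `U a`
    have hstep : ∀ ξ : Finset (Sym2 V), ξ ⊆ G.edgeFinset \ U a →
        (rcMeasure G p q B).real ((A ∩ (S a)ᶜ) ∩ {ω | ω ∩ (↑(U a) : Set (Sym2 V))ᶜ = ↑ξ}) ≤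
          (1 - c a) * (rcMeasure G p q B).real (A ∩ {ω | ω ∩ (↑(U a) : Set (Sym2 V))ᶜ = ↑ξ}) :=
      fun ξ hξ ↦ rcMeasure_real_inter_compl_inter_cylinder_le G hp hq B _ _ hA
        (hS a (Finset.mem_insert_self a s)) (hc a (Finset.mem_insert_self a s) ξ hξ)
    have h1ca : 0 ≤ 1 - c a := sub_nonneg.2 (hc1 a (Finset.mem_insert_self a s))
    calc (rcMeasure G p q B).real (A ∩ ((S a)ᶜ ∩ ⋂ i ∈ s, (S i)ᶜ))
        = (rcMeasure G p q B).real ((A ∩ (S a)ᶜ) ∩ ⋂ i ∈ s, (S i)ᶜ) := by rw [Set.inter_assoc]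
      _ ≤ (1 - c a) * (rcMeasure G p q B).real (A ∩ ⋂ i ∈ s, (S i)ᶜ) :=
          rcMeasure_real_inter_le_mul_inter_of_cylinder_le G hp hq0 B (U a) hF hstep
      _ ≤ (1 - c a) * ((∏ i ∈ s, (1 - c i)) * (rcMeasure G p q B).real A) :=
          mul_le_mul_of_nonneg_left ih' h1ca
      _ = ((1 - c a) * ∏ i ∈ s, (1 - c i)) * (rcMeasure G p q B).real A := by ring

end Finite

end Literature.Probability.LatticeModels

end
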